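import Summits.Ventures.CertifiedManyBodySolver.Rows.DopedTLCorrThermal
import Summits.Ventures.CertifiedManyBodySolver.Observables.StiffnessApexTransportThermalHinge
import HarnessLib

/-!
# Ventures/CertifiedManyBodySolver — Observables/StiffnessThermalRowTransport.lean: a THERMAL NODE at a station moved up its iso-`βU` ray —
# the composition «same-point thermal row (Rows/DopedTLCorrThermal) ∘ thermal apex row (no bracket at half filling)»

HONEST FRAMING: one-sided CEILINGS on the thermal uniform flux stiffness, conditional BY NAME on a THERMAL row (a node shape the pen may or may not type;
warrant `Literature/…/HubbardTTPrimeWindowCertificateThermal`); CONTROL / CALIBRATION class; no phase sentence; no number. Cell `pub/hubbard-downfold`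
(D-0096 (2) «T > 0» leg), seat `hubbard-downfold-unc-2` (`prover-hubbard-downfold-unc-2-g18-0`). Zero compute, no definition, no claim node, no `sorry`.

THE POINT. A thermal row at the station `A = (t′_A, U_A, n)` holds at EVERY `β_A`; the thermal apex row (`HubbardTTPrimeApexRowThermal`, exact, no price) moves a thermal
word from `(β_A, U_A)` to `(β_P, U_P)` with `β_A U_A = β_P U_P`. So for a target `(t′_P, U_P > U_A)` on `A`'s apex segment and a target temperature `β_P`, read the
row at `β_A = β_P U_P/U_A` (COLDER than the target): price `κ·2H_b(n/2)/β_A = κ·2H_b(n/2)·U_A/(U_P β_P)` — versus the ground → thermal route's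
`U_A·2H_b(n/2)/(4β_P(U_P − U_A))`, i.e. smaller by the factor `4κ(U_P − U_A)/U_P` and finite down to `U_P = U_A`.
* §1 half filling, OWN objective (thermal hinge at the source, `HubbardTTPrimeThermalHalfFillingHinge`): `…_halfFilling_of_thermalRow_isoBetaU`;
* §2 any density, TARGET-slot objective `−X₀(t′_P)` certified at the source (no hinge): `…_of_thermalRow_targetSlot_isoBetaU`.

References: E. H. Lieb, CMP 31 (1973) 327, §V [Lieb1973]; J. Wang et al., PRX 14 (2024) 031006, §III [WangEtAl2024]; D. J. Scalapino, S. R. White, S.-C. Zhang,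
PRB 47 (1993) 7995, §II [ScalapinoWhiteZhang1993].
-/

noncomputable section

namespace Summit.Ventures.CertifiedManyBodySolver.Observables

open Filter Topology Matrix Finset
open Literature.MathematicalPhysics.QuantumLattice
open Literature.MathematicalPhysics.QuantumLattice.InfVolFermionState
open Literature.MathematicalPhysics.QuantumLattice.ThermodynamicLimit
open Literature.MathematicalPhysics.QuantumFieldTheory
open Literature.MathematicalPhysics.StatisticalMechanics
open Literature.MathematicalPhysics.StatisticalMechanics.KosterlitzThouless
open Literature.Probability.LatticeModels
open Summit.Ventures.CertifiedManyBodySolver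
open scoped ComplexConjugate ComplexOrder

variable {t'A UA t'P UP βP : ℝ} {u r κ : ℚ}

/-- **THERMAL ROW AT THE STATION ⇒ LEAF UP THE ISO-`βU` RAY (half filling, own objective).** `0 < U_A < U_P`, `0 < β_P`, `U_P t′_A = (2U_P − U_A) t′_P`; a thermal row
`SquareTTPrimeCorrThermalOrbitLowerRow t′_A U_A 1 u r κ univ Λ₇ (−X₀(t′_A))` with its cap `e(1,t′_A,U_A,1) ≤ u` certified. Then
`ObsThermalStiffnessSeqCeilingAtBeta t′_P U_P 1 β_P c` for every `c ≥ −r + κ·2H_b(1/2)·U_A/(U_P β_P)` (the row read at `β_A = β_P U_P/U_A`, then the thermal apex row with the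
hinge at the source). [cite: Lieb1973, §V (5.2)–(5.4)] [cite: WangEtAl2024, §III] -/
theorem ObsThermalStiffnessSeqCeilingAtBeta_halfFilling_of_thermalRow_isoBetaU (hUA : 0 < UA) (hU : UA < UP) (hβP : 0 < βP)
    (hapex : UP * t'A = (2 * UP - UA) * t'P)
    (hT : SquareTTPrimeCorrThermalOrbitLowerRow t'A UA 1 u r κ Finset.univ (box 2 7) (-oddMomentObsTT t'A UA 0))
    (hu : energyDensityTT' 1 t'A UA 1 ≤ ((u : ℚ) : ℝ)) (c : ℚ)
    (hc : -((r : ℚ) : ℝ) + ((κ : ℚ) : ℝ) * (2 * Real.binEntropy ((1 : ℝ) / 2)) * UA / (UP * βP) ≤ ((c : ℚ) : ℝ)) :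
    ObsThermalStiffnessSeqCeilingAtBeta t'P UP 1 βP c := by
  have hUP : 0 < UP := hUA.trans hU
  set βA : ℝ := βP * UP / UA with hβA
  have hβA0 : 0 < βA := by rw [hβA]; positivity
  have hβ : βP < βA := by
    rw [hβA, lt_div_iff₀ hUA]; nlinarith
  have hγ : βA * UA = βP * UP := by rw [hβA]; field_simp
  have hapexβ : βA * t'A = (2 * βA - βP) * t'P := by
    have h1 : βA * t'A * UA = ((2 * βA - βP) * t'P) * UA := by
      rw [hβA]
      field_simp
      nlinarith [hapex]
    exact mul_right_cancel₀ hUA.ne' h1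
  -- the thermal source floor from the row at `β_A`
  have hℓ : ∀ (ωA : InfVolFermionState 2) (LsA : ℕ → ℕ), Tendsto LsA atTop atTop →
      ωA.IsTorusLimitOfMixture (sectorGibbsCount 1) (fun L => sectorGibbsWeightTT' βA 1 t'A UA 1 L)
        (fun L => sectorGibbsVectorTT' 1 t'A UA 1 L) LsA →
      4 * (((r : ℚ) : ℝ) - ((κ : ℚ) : ℝ) * (2 * Real.binEntropy ((1 : ℝ) / 2) / βA)) ≤
        ωA.meanEnergy (hubbardTTPrimeFermionInteraction 1 (2 * t'A) 0) 1 := by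
    intro ωA LsA hLsA hωA
    have h := hT βA hβA0 ωA LsA hLsA hωA hu
    rw [orbitMean_re_expect_neg_oddMomentTT_lam_zero hωA.isTranslationInvariant] at h
    linarith
  refine ObsThermalStiffnessSeqCeilingAtBeta_of_torusLimit_kinetic_le hβP zero_le_one one_le_two fun ω Ls hLs hω => ?_
  have hfl := IsTorusLimitOfMixture.le_meanEnergy_twice_tPrime_of_forall_source_ownWord_thermal_halfFilling (t := 1) hβP hβ hγ hUA.le
    hapexβ hℓ hω hLs
  rw [re_expect_kinBondObsTT_eq_of_isD4Invariant hω.isTranslationInvariant (hω.isD4Invariant_of_sectorGibbs 1 t'P UP 1 βP hLs) t'P]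
  have hco := InfVolFermionState.meanEnergy_hubbardTTPrime_eq_coords ω 1 (2 * t'P) 0
  rw [one_mul, zero_mul, add_zero] at hco
  rw [← hco]
  have hprice : ((κ : ℚ) : ℝ) * (2 * Real.binEntropy ((1 : ℝ) / 2) / βA) =
      ((κ : ℚ) : ℝ) * (2 * Real.binEntropy ((1 : ℝ) / 2)) * UA / (UP * βP) := by
    rw [hβA]
    field_simp
  linarith [hprice]

/-- **THERMAL ROW FOR THE TARGET-SLOT OBJECTIVE ⇒ LEAF UP THE ISO-`βU` RAY (any density, no hinge).** `0 ≤ n < 2`, `0 < U_A < U_P`, `0 < β_P`,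
`U_P t′_A = (2U_P − U_A) t′_P`; a thermal row at the source for the TARGET's objective `−X₀(t′_P)` (slot `Uo`), cap certified ⇒
`ObsThermalStiffnessSeqCeilingAtBeta t′_P U_P n β_P c` for every `c ≥ −r + κ·2H_b(n/2)·U_A/(U_P β_P)`. [cite: Lieb1973, §V (5.2)–(5.4)] [cite: WangEtAl2024, §III] -/
theorem ObsThermalStiffnessSeqCeilingAtBeta_of_thermalRow_targetSlot_isoBetaU (Uo : ℝ) {n : ℝ} (hn0 : 0 ≤ n) (hn2 : n < 2)
    (hUA : 0 < UA) (hU : UA < UP) (hβP : 0 < βP) (hapex : UP * t'A = (2 * UP - UA) * t'P)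
    (hT : SquareTTPrimeCorrThermalOrbitLowerRow t'A UA n u r κ Finset.univ (box 2 7) (-oddMomentObsTT t'P Uo 0))
    (hu : energyDensityTT' 1 t'A UA n ≤ ((u : ℚ) : ℝ)) (c : ℚ)
    (hc : -((r : ℚ) : ℝ) + ((κ : ℚ) : ℝ) * (2 * Real.binEntropy (n / 2)) * UA / (UP * βP) ≤ ((c : ℚ) : ℝ)) :
    ObsThermalStiffnessSeqCeilingAtBeta t'P UP n βP c := by
  have hUP : 0 < UP := hUA.trans hU
  set βA : ℝ := βP * UP / UA with hβA
  have hβA0 : 0 < βA := by rw [hβA]; positivity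
  have hβ : βP < βA := by
    rw [hβA, lt_div_iff₀ hUA]; nlinarith
  have hγ : βA * UA = βP * UP := by rw [hβA]; field_simp
  have hapexβ : βA * t'A = (2 * βA - βP) * t'P := by
    have h1 : βA * t'A * UA = ((2 * βA - βP) * t'P) * UA := by
      rw [hβA]
      field_simp
      nlinarith [hapex]
    exact mul_right_cancel₀ hUA.ne' h1
  have hℓ : ∀ (ωA : InfVolFermionState 2) (LsA : ℕ → ℕ), Tendsto LsA atTop atTop →
      ωA.IsTorusLimitOfMixture (sectorGibbsCount n) (fun L => sectorGibbsWeightTT' βA 1 t'A UA n L)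
        (fun L => sectorGibbsVectorTT' 1 t'A UA n L) LsA →
      4 * (((r : ℚ) : ℝ) - ((κ : ℚ) : ℝ) * (2 * Real.binEntropy (n / 2) / βA)) ≤
        ωA.meanEnergy (hubbardTTPrimeFermionInteraction 1 (2 * t'P) 0) 1 := by
    intro ωA LsA hLsA hωA
    have h := hT βA hβA0 ωA LsA hLsA hωA hu
    rw [orbitMean_re_expect_neg_oddMomentTT_lam_zero hωA.isTranslationInvariant] at h
    linarith
  refine ObsThermalStiffnessSeqCeilingAtBeta_of_thermalApexSource_floor hn0 hn2.le hβP hβ hγ hapexβ hℓ c ?_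
  have hprice : ((κ : ℚ) : ℝ) * (2 * Real.binEntropy (n / 2) / βA) =
      ((κ : ℚ) : ℝ) * (2 * Real.binEntropy (n / 2)) * UA / (UP * βP) := by
    rw [hβA]
    field_simp
  linarith [hprice]

end Summit.Ventures.CertifiedManyBodySolver.Observables

end
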